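import Summits.Ventures.PercRepro.TheoremW

/-!
# Conditional negative correlation of two clusters (van den Berg–Häggström–Kahn, Theorem 1.4)

For Bernoulli bond percolation on a finite multigraph `G`, two vertices `s`, `t`, an event `A`
determined by and increasing in the open cluster `C_s` (`G.ClusterDet s A`) and an event `B`
determined by and increasing in `C_t` (`G.ClusterDet t B`), conditionally on `{s ↮ t}` the
events `A` and `B` are *negatively* correlated:

  `P(A ∩ B ∩ {s ↮ t}) · P(s ↮ t) ≤ P(A ∩ {s ↮ t}) · P(B ∩ {s ↮ t})`   (`clusterDet_neg_corr`).

With `A = {s ↔ a}`, `B = {t ↔ b}` this is inequality (1.2) of van den Berg–Häggström–Kahn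
(2006) and, relabelled, the cell's row C-002: `P(a ↔ b, c ↔ d, a ↮ c) · P(a ↮ c) ≤
P(a ↔ b, a ↮ c) · P(c ↔ d, a ↮ c)` (`conn_neg_corr_of_sep`).

Proof (following the published proof of their Theorem 1.5): decompose over the open cluster
`C_s = W`.  Conditionally on `C_s = W` (with `t ∉ W`), the configuration on the edges not
touching `W` is again product percolation, with the edges touching `W` switched off; so
`P(B ∩ {C_s = W}) = P(C_s = W) · P_{zeroOn p (edges at W)}(B)` (`expect_ite_cluster_eq_indicator`).
The function `H(ω) = P_{zeroOn p (edges at C_s(ω))}(B)` is determined by `C_s` and *decreasing*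
in it, while `1_A` is increasing in `C_s`; the mixed form of Theorem 1.3
(`conditional_fkg_expect_anti`, a corollary of Theorem W) gives the inequality.
-/

namespace PercRepro

open Finset

namespace MultiGraph

variable {V E : Type*} (G : MultiGraph V E)

/-! ### The edges touching a vertex set; the cluster of `s` under a revealed configuration -/

section Touching

/-- The edges touching a vertex set `X`: those with at least one endpoint in `X`. -/
def touching (X : Set V) : Set E := {e | G.fst e ∈ X ∨ G.snd e ∈ X}

/-- Membership in `touching`. -/
theorem mem_touching {X : Set V} {e : E} :
    e ∈ G.touching X ↔ (G.fst e ∈ X ∨ G.snd e ∈ X) := Iff.rfl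

/-- `touching` is monotone. -/
theorem touching_mono {X X' : Set V} (h : X ⊆ X') : G.touching X ⊆ G.touching X' :=
  fun _ he => he.imp (fun h1 => h h1) fun h2 => h h2

variable [Fintype E]

open Classical in
/-- The edges touching `X`, as a `Finset` (the set `K` switched off by `zeroOn` when the cluster
`X` is revealed). -/
noncomputable def touchingFinset (X : Set V) : Finset E := univ.filter (· ∈ G.touching X)

/-- Membership in `touchingFinset`. -/
theorem mem_touchingFinset {X : Set V} {e : E} :
    e ∈ G.touchingFinset X ↔ (G.fst e ∈ X ∨ G.snd e ∈ X) := by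
  simp [touchingFinset, touching]

/-- `touchingFinset` is monotone. -/
theorem touchingFinset_mono {X X' : Set V} (h : X ⊆ X') :
    G.touchingFinset X ⊆ G.touchingFinset X' := by
  intro e he
  rw [mem_touchingFinset] at he ⊢
  exact he.imp (fun h1 => h h1) fun h2 => h h2

end Touching

variable {G}

/-- For `ω` closed on the edges `K` at `W`, the cluster of `s` in `ζ ⊔ ω` is `W` iff the
cluster of `s` in `ζ` is `W`. -/
theorem cluster_sup_eq_iff (s : V) {W : Set V} {K : Finset E}
    (hK : ∀ e, e ∈ K ↔ (G.fst e ∈ W ∨ G.snd e ∈ W)) {ζ ω : Config E}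
    (hω : ∀ e ∈ K, ω e = false) :
    G.cluster (ζ ⊔ ω) s = W ↔ G.cluster ζ s = W := by
  constructor
  · intro h
    refine Set.Subset.antisymm (by rw [← h]; exact G.cluster_mono le_sup_left s) ?_
    intro v hv
    rw [← h] at hv
    refine Conn.induction (motive := fun v => G.Conn ζ s v) (Conn.refl G ζ s)
      (fun {a b} hsa hab ha => ?_) hv
    obtain ⟨e, he, hend⟩ := hab
    have haW : a ∈ W := by rw [← h]; exact hsa
    have heK : e ∈ K := by
      rw [hK]
      rcases hend with ⟨h1, _⟩ | ⟨_, h1⟩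
      · exact Or.inl (h1 ▸ haW)
      · exact Or.inr (h1 ▸ haW)
    have hζe : ζ e = true := by
      rcases sup_apply_eq_true_iff.1 he with h' | h'
      · exact h'
      · exact absurd h' (by simp [hω e heK])
    exact ha.trans (Conn.of_openAdj ⟨e, hζe, hend⟩)
  · intro h
    refine Set.Subset.antisymm ?_ (by rw [← h]; exact G.cluster_mono le_sup_left s)
    intro v hv
    have hsW : s ∈ W := by rw [← h]; exact G.self_mem_cluster ζ s
    refine mem_of_conn_of_closed_boundary (X := W) ?_ hsW hv
    intro e he
    rcases sup_apply_eq_true_iff.1 he with hζe | hωe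
    · have hadj := Conn.of_openAdj (G.openAdj_of_open e hζe)
      constructor
      · intro h1
        rw [← h] at h1 ⊢
        exact h1.trans hadj
      · intro h2
        rw [← h] at h2 ⊢
        exact h2.trans hadj.symm
    · have hnK : e ∉ K := fun hK' => by simp [hω e hK'] at hωe
      rw [hK] at hnK
      exact ⟨fun h1 => absurd (Or.inl h1) hnK, fun h2 => absurd (Or.inr h2) hnK⟩

/-- If the cluster of `s` in `ζ ⊔ ω` is `W`, `t ∉ W`, and `ζ` is supported on the edges at `W`,
then the cluster of `t` in `ζ ⊔ ω` is its cluster in `ω`. -/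
theorem cluster_sup_eq_of_cluster_eq (s t : V) {W : Set V} {K : Finset E}
    (hK : ∀ e, e ∈ K ↔ (G.fst e ∈ W ∨ G.snd e ∈ W)) {ζ ω : Config E}
    (hζ : ∀ e ∉ K, ζ e = false) (h : G.cluster (ζ ⊔ ω) s = W) (ht : t ∉ W) :
    G.cluster (ζ ⊔ ω) t = G.cluster ω t := by
  apply cluster_sup_eq_of_avoid (Z := W)
  · intro e he
    by_contra hcon
    have hnK : e ∉ K := fun hK' => hcon ((hK e).1 hK')
    simp [hζ e hnK] at he
  · intro w hw hconn
    apply ht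
    rw [← h] at hw ⊢
    exact hw.trans hconn.symm

/-! ### Conditional independence given `C_s = W` -/

section Prob

variable [Fintype E] [DecidableEq E]

open Classical in
/-- **Conditional independence given the cluster of `s`.**  For `B` determined by the cluster
of `t` and `t ∉ W`, with `K` the edges touching `W`:
`E[1_{C_s = W} · 1_B] = P_{zeroOn p K}(B) · E[1_{C_s = W}]`, i.e.
`P(B ∩ {C_s = W}) = P(C_s = W) · P_{zeroOn p K}(B)`. -/
theorem expect_ite_cluster_eq_indicator (s t : V) (p : E → ℝ) {B : Set (Config E)}
    (hB : G.ClusterDet t B) {W : Set V} (ht : t ∉ W) {K : Finset E}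
    (hK : ∀ e, e ∈ K ↔ (G.fst e ∈ W ∨ G.snd e ∈ W)) :
    expect p (fun ω => if G.cluster ω s = W then B.indicator 1 ω else 0) =
      prob (zeroOn p K) B * expect p (fun ω => if G.cluster ω s = W then 1 else 0) := by
  rw [expect_eq_sum_keepOn p K, expect_eq_sum_keepOn p K (fun ω => if G.cluster ω s = W then 1 else 0),
    Finset.mul_sum]
  refine Finset.sum_congr rfl fun ζ _ => ?_
  by_cases hw : weight (keepOn p K) ζ = 0
  · rw [hw]
    ring
  · have hζ := closedOff_of_weight_keepOn_ne_zero hw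
    have e1 : expect (zeroOn p K)
        (fun ω => if G.cluster (ζ ⊔ ω) s = W then B.indicator 1 (ζ ⊔ ω) else 0) =
          (if G.cluster ζ s = W then 1 else 0) * expect (zeroOn p K) (B.indicator 1) := by
      by_cases hW : G.cluster ζ s = W
      · rw [if_pos hW, one_mul]
        apply expect_congr_of_support
        intro ω hω
        have hωK := closedOn_of_weight_zeroOn_ne_zero hω
        have hc : G.cluster (ζ ⊔ ω) s = W := (cluster_sup_eq_iff s hK hωK).2 hW
        rw [if_pos hc]
        have hiff : ζ ⊔ ω ∈ B ↔ ω ∈ B :=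
          hB.mem_iff_of_eq (cluster_sup_eq_of_cluster_eq s t hK hζ hc ht)
        by_cases hb : ω ∈ B
        · rw [Set.indicator_of_mem hb, Set.indicator_of_mem (hiff.2 hb)]
          rfl
        · rw [Set.indicator_of_notMem hb, Set.indicator_of_notMem (fun h => hb (hiff.1 h))]
      · rw [if_neg hW, zero_mul]
        calc expect (zeroOn p K)
              (fun ω => if G.cluster (ζ ⊔ ω) s = W then B.indicator 1 (ζ ⊔ ω) else 0)
            = expect (zeroOn p K) (fun _ => (0 : ℝ)) := by
              apply expect_congr_of_support
              intro ω hω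
              have hωK := closedOn_of_weight_zeroOn_ne_zero hω
              rw [if_neg (fun hc => hW ((cluster_sup_eq_iff s hK hωK).1 hc))]
          _ = 0 := expect_const _ 0
    have e2 : expect (zeroOn p K) (fun ω => if G.cluster (ζ ⊔ ω) s = W then (1 : ℝ) else 0) =
        (if G.cluster ζ s = W then 1 else 0) := by
      by_cases hW : G.cluster ζ s = W
      · rw [if_pos hW]
        calc expect (zeroOn p K) (fun ω => if G.cluster (ζ ⊔ ω) s = W then (1 : ℝ) else 0)
            = expect (zeroOn p K) (fun _ => (1 : ℝ)) := by
              apply expect_congr_of_support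
              intro ω hω
              have hωK := closedOn_of_weight_zeroOn_ne_zero hω
              rw [if_pos ((cluster_sup_eq_iff s hK hωK).2 hW)]
          _ = 1 := expect_const _ 1
      · rw [if_neg hW]
        calc expect (zeroOn p K) (fun ω => if G.cluster (ζ ⊔ ω) s = W then (1 : ℝ) else 0)
            = expect (zeroOn p K) (fun _ => (0 : ℝ)) := by
              apply expect_congr_of_support
              intro ω hω
              have hωK := closedOn_of_weight_zeroOn_ne_zero hω
              rw [if_neg (fun hc => hW ((cluster_sup_eq_iff s hK hωK).1 hc))]
          _ = 0 := expect_const _ 0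
    rw [e1, e2, prob_eq_expect_indicator]
    ring

open Classical in
/-- Decomposition of an expectation over the value of the cluster of `s`. -/
theorem expect_eq_sum_cluster (s : V) (p : E → ℝ) (F : Config E → ℝ) :
    expect p F = ∑ W ∈ univ.image (fun ω => G.cluster ω s),
      expect p (fun ω => if G.cluster ω s = W then F ω else 0) := by
  unfold expect
  rw [Finset.sum_comm]
  refine Finset.sum_congr rfl fun ω _ => ?_
  rw [← Finset.mul_sum]
  congr 1
  simp only []
  rw [Finset.sum_ite_eq, if_pos (Finset.mem_image_of_mem _ (Finset.mem_univ ω))]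

open Classical in
/-- **Integrating out `B` given the cluster of `s`.**  For `B` determined by the cluster of `t`
and a function `Ψ` of the cluster of `s` vanishing whenever `t` is in the cluster,
`E[Ψ(C_s) · 1_B] = E[Ψ(C_s) · H]` with `H(ω) = P_{zeroOn p (edges at C_s(ω))}(B)`. -/
theorem expect_clusterFun_mul_indicator (s t : V) (p : E → ℝ) {B : Set (Config E)}
    (hB : G.ClusterDet t B) (Ψ : Set V → ℝ) (hΨ : ∀ W, t ∈ W → Ψ W = 0) :
    expect p (fun ω => Ψ (G.cluster ω s) * B.indicator 1 ω) =
      expect p (fun ω => Ψ (G.cluster ω s) * prob (zeroOn p (G.touchingFinset (G.cluster ω s))) B) := by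
  rw [expect_eq_sum_cluster s p, expect_eq_sum_cluster s p
    (fun ω => Ψ (G.cluster ω s) * prob (zeroOn p (G.touchingFinset (G.cluster ω s))) B)]
  refine Finset.sum_congr rfl fun W _ => ?_
  have e1 : (fun ω => if G.cluster ω s = W then Ψ (G.cluster ω s) * B.indicator 1 ω else 0) =
      fun ω => Ψ W * (if G.cluster ω s = W then B.indicator 1 ω else 0) := by
    funext ω
    split_ifs with hc
    · rw [hc]
    · ring
  have e2 : (fun ω => if G.cluster ω s = W then
        Ψ (G.cluster ω s) * prob (zeroOn p (G.touchingFinset (G.cluster ω s))) B else 0) =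
      fun ω => (Ψ W * prob (zeroOn p (G.touchingFinset W)) B) *
        (if G.cluster ω s = W then 1 else 0) := by
    funext ω
    split_ifs with hc
    · rw [hc]
      ring
    · ring
  rw [e1, e2, expect_const_mul, expect_const_mul]
  by_cases ht : t ∈ W
  · rw [hΨ W ht, zero_mul, zero_mul, zero_mul]
  · rw [expect_ite_cluster_eq_indicator s t p hB ht (fun e => G.mem_touchingFinset)]
    ring

/-! ### The theorem -/

open Classical in
/-- The indicator of a cluster-determined event as a function of the cluster. -/
theorem ClusterDet.indicator_eq (s : V) {A : Set (Config E)} (hA : G.ClusterDet s A)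
    (ω : Config E) :
    A.indicator 1 ω =
      (if ∃ ω', G.cluster ω' s = G.cluster ω s ∧ ω' ∈ A then (1 : ℝ) else 0) := by
  by_cases hω : ω ∈ A
  · rw [Set.indicator_of_mem hω, if_pos ⟨ω, rfl, hω⟩]
    rfl
  · rw [Set.indicator_of_notMem hω, if_neg]
    rintro ⟨ω', hc, hω'⟩
    exact hω ((hA.mem_iff_of_eq hc).1 hω')

/-- **van den Berg–Häggström–Kahn (2006), Theorem 1.4** (event form): for `A` determined by and
increasing in the cluster of `s`, and `B` determined by and increasing in the cluster of `t`,
conditionally on `s ↮ t` the events `A` and `B` are negatively correlated: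
`P(A ∩ B ∩ {s ↮ t}) · P(s ↮ t) ≤ P(A ∩ {s ↮ t}) · P(B ∩ {s ↮ t})`. -/
theorem clusterDet_neg_corr (s t : V) {A B : Set (Config E)} (hA : G.ClusterDet s A)
    (hB : G.ClusterDet t B) {p : E → ℝ} (hp : IsProb p) :
    prob p (A ∩ B ∩ G.sepEvent s t) * prob p (G.sepEvent s t) ≤
      prob p (A ∩ G.sepEvent s t) * prob p (B ∩ G.sepEvent s t) := by
  classical
  set R := G.sepEvent s t with hR
  -- the conditional probability of `B` given the cluster of `s`
  set H : Config E → ℝ := fun ω => prob (zeroOn p (G.touchingFinset (G.cluster ω s))) B with hHdef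
  have hH : G.ClusterAnti s H := by
    intro ω ω' hle
    refine prob_mono_of_isUpperSet (isProb_zeroOn hp _) (isProb_zeroOn hp _) ?_ hB.isUpperSet
    intro e
    by_cases he : e ∈ G.touchingFinset (G.cluster ω' s)
    · rw [zeroOn_apply_of_mem p he]
      exact (isProb_zeroOn hp _).nonneg e
    · have he' : e ∉ G.touchingFinset (G.cluster ω s) := fun h => he (G.touchingFinset_mono hle h)
      rw [zeroOn_apply_of_notMem p he, zeroOn_apply_of_notMem p he']
  have hH1 : ∀ ω, H ω ≤ 1 := fun ω => prob_le_one (isProb_zeroOn hp _) B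
  have key := G.conditional_fkg_expect_anti s hA.clusterMono_indicator hH
    (fun _ => Set.indicator_nonneg (fun _ _ => zero_le_one) _) hH1 hp {t}
  rw [G.sepAllEvent_singleton s t, ← hR] at key
  -- membership in `R` in terms of the cluster of `s`
  have hRt : ∀ ω, ω ∈ R ↔ t ∉ G.cluster ω s := fun ω => Iff.rfl
  -- the two decompositions
  let Φ : Set V → ℝ := fun W => if ∃ ω', G.cluster ω' s = W ∧ ω' ∈ A then 1 else 0
  let Ψ₁ : Set V → ℝ := fun W => if t ∈ W then 0 else Φ W
  let Ψ₂ : Set V → ℝ := fun W => if t ∈ W then 0 else 1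
  have i1 : expect p (R.indicator (A.indicator 1 * H)) = prob p (A ∩ B ∩ R) := by
    have d1 : R.indicator (A.indicator 1 * H) = fun ω => Ψ₁ (G.cluster ω s) * H ω := by
      funext ω
      by_cases hω : ω ∈ R
      · rw [Set.indicator_of_mem hω]
        simp only [Ψ₁, Φ, Pi.mul_apply, if_neg ((hRt ω).1 hω)]
        rw [hA.indicator_eq s ω]
      · rw [Set.indicator_of_notMem hω]
        have : t ∈ G.cluster ω s := by
          by_contra h
          exact hω ((hRt ω).2 h)
        simp only [Ψ₁, if_pos this, zero_mul]
    have d2 : (fun ω => Ψ₁ (G.cluster ω s) * B.indicator 1 ω) = (A ∩ B ∩ R).indicator 1 := by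
      funext ω
      by_cases hω : ω ∈ R
      · simp only [Ψ₁, Φ, if_neg ((hRt ω).1 hω)]
        rw [← hA.indicator_eq s ω]
        by_cases ha : ω ∈ A <;> by_cases hb : ω ∈ B <;>
          simp [Set.indicator, ha, hb, hω]
      · have : t ∈ G.cluster ω s := by
          by_contra h
          exact hω ((hRt ω).2 h)
        simp only [Ψ₁, if_pos this, zero_mul]
        rw [Set.indicator_of_notMem (fun h => hω h.2)]
    rw [d1, ← expect_clusterFun_mul_indicator s t p hB Ψ₁ (fun W hW => by simp [Ψ₁, hW]), d2,
      expect_indicator_one]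
  have i2 : expect p (R.indicator H) = prob p (B ∩ R) := by
    have d1 : R.indicator H = fun ω => Ψ₂ (G.cluster ω s) * H ω := by
      funext ω
      by_cases hω : ω ∈ R
      · rw [Set.indicator_of_mem hω]
        simp [Ψ₂, if_neg ((hRt ω).1 hω)]
      · rw [Set.indicator_of_notMem hω]
        have : t ∈ G.cluster ω s := by
          by_contra h
          exact hω ((hRt ω).2 h)
        simp only [Ψ₂, if_pos this, zero_mul]
    have d2 : (fun ω => Ψ₂ (G.cluster ω s) * B.indicator 1 ω) = (B ∩ R).indicator 1 := by
      funext ω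
      by_cases hω : ω ∈ R
      · simp only [Ψ₂, if_neg ((hRt ω).1 hω), one_mul]
        by_cases hb : ω ∈ B <;> simp [Set.indicator, hb, hω]
      · have : t ∈ G.cluster ω s := by
          by_contra h
          exact hω ((hRt ω).2 h)
        simp only [Ψ₂, if_pos this, zero_mul]
        rw [Set.indicator_of_notMem (fun h => hω h.2)]
    rw [d1, ← expect_clusterFun_mul_indicator s t p hB Ψ₂ (fun W hW => by simp [Ψ₂, hW]), d2,
      expect_indicator_one]
  have i3 : expect p (R.indicator (A.indicator 1)) = prob p (A ∩ R) :=
    expect_indicator_indicator_one p A R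
  rw [i1, i2, i3] at key
  exact key

/-- **C-002** (van den Berg–Häggström–Kahn 2006, inequality (1.2)): conditionally on `a ↮ c`, the
connection events `a ↔ b` and `c ↔ d` are negatively correlated,
`P(a ↔ b, c ↔ d, a ↮ c) · P(a ↮ c) ≤ P(a ↔ b, a ↮ c) · P(c ↔ d, a ↮ c)`. -/
theorem conn_neg_corr_of_sep (a b c d : V) {p : E → ℝ} (hp : IsProb p) :
    prob p (G.connEvent a b ∩ G.connEvent c d ∩ G.sepEvent a c) * prob p (G.sepEvent a c) ≤
      prob p (G.connEvent a b ∩ G.sepEvent a c) * prob p (G.connEvent c d ∩ G.sepEvent a c) :=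
  G.clusterDet_neg_corr a c (G.clusterDet_connEvent a b) (G.clusterDet_connEvent c d) hp

end Prob

end MultiGraph

end PercRepro
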